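import Literature.AlgebraicGeometry.Resolution.FormalFibresRegularProofs
import Literature.AlgebraicGeometry.Resolution.AdicCompletionRegular
import Literature.RingTheory.CompleteLocalRings.CoefficientField
import Literature.RingTheory.CompleteLocalRings.CoefficientFieldCharP
import Mathlib.RingTheory.AdicCompletion.LocalRing
import Mathlib.RingTheory.MvPowerSeries.Inverse
import HarnessLib

/-!
# [OURS · L1 W4.2 · D14 ROUTE H/G «K1 FREE-RATIONAL TAILS»] G1a-1: the BASE FORMAL FRAME
# (Cohen coordinates of the completion adapted to a GIVEN regular system of parameters; crux `SigmaMaxModifications`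
# stmt-ResolutionOfSingularities-18506 / conjunct stmt-…-19249; kernel `IsoQuadraticTowerTerminates p 3`, card C5 K1)

Prover res-type-038 (gen 21) on res-L1-w42-lead-1's CUT G1a (2026-08-27T10:43:09Z, res-L1-w42-plan-1 RULING v3.14-12a
(BR-9)/(CF)), piece **(G1a-1) BASE FRAME**. Helper file `--supports stmt-ResolutionOfSingularities-19249 --as helper`; kernel
only, no definitions, no named fact. OURS (cell res-hironaka, slot W4.2); NOT statements of [Hironaka2017] nor of
[CossartJannsenSaito2020] / [CossartPiltant2009]. AI-written; AI review is weaker than expert review.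

## The object

Stage `n₀` of an isolated point tower presents its local ring as a quotient of a REGULAR local ring `R` with a chosen regular
system of parameters `x = (t, y₁, …)` (`x 0 = t` the exceptional equation). The frames of lead-1's
`…IsoTailsFormalFrameStep` / `…IsoTailsFormalFrameTower` (`FormalFrame.stepFrame`, `FormalFrame.mem_pow_of_frameTower`) are LOCAL ring
homomorphisms `ψ : R → κ⟦X⟧` with `ψ t = X 0`; this file builds the FIRST one, `ψ₀`, from Cohen's structure theorem in the sharp
form «a regular system of parameters becomes the system of variables» (Matsumura Thm. 29.7 / proof of 29.4), over the tree's
`exists_adicEvalHom` + `comp_map_bijective` (`Literature/AlgebraicGeometry/Resolution/FormalFibresRegularProofs.lean`) applied to the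
completion `R̂ := AdicCompletion (maximalIdeal R) R` (regular: tree `isRegularLocalRing_adicCompletion`, Stacks 07NY; local, complete,
`𝔪̂ = 𝔪R̂`, same embedding dimension and residue field: Mathlib `AdicCompletion.*`), with coefficient field a section `σ` of the residue
map of `R̂` (tree `Literature.RingTheory.CompleteLocalRings.exists_ringHom_comp_residue_eq_id_of_subring` / `…_of_charP`,
Matsumura Thm. 28.3 (ii)). Everything is for ANY embedding dimension `d` (ROUTE G is the general-stage route; ROUTE H uses `d = 4`).

* `exists_cohenEquiv_of_rsop` — `R` regular local containing a field `k₀`, `(maximalIdeal R).spanFinrank = d`, `x : Fin d → R` with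
  `span (range x) = 𝔪`: there are a section `σ : κ →+* R̂` of `residue R̂` (`κ := ResidueField R̂`) and a ring isomorphism
  `Ψ : κ⟦X_0, …, X_{d-1}⟧ ≃+* R̂` with `Ψ (X i) = x i` and `Ψ (C a) = σ a`.
* `exists_baseFrame_of_rsop` — the BASE FRAME `ψ₀ := Ψ⁻¹ ∘ (R → R̂) : R →+* κ⟦X⟧`: `IsLocalHom ψ₀`, `ψ₀ (x i) = X i`, residue
  surjectivity `∀ a : κ, ∃ r : R, ψ₀ r − C a ∈ 𝔪_{κ⟦X⟧}`, and `Ψ (ψ₀ r) = r` in `R̂` — exactly the three hypotheses lead-1's step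
  consumes (with slope `λ = 0` at stage 0), plus the comparison with the completion for H7/H8.
* `exists_cohenEquiv_of_rsop_of_charP` / `exists_baseFrame_of_rsop_of_charP` — the same for `R` of prime characteristic `p`
  (the field `𝔽_p ⊆ R`; the W4.2 stages are local rings of schemes over a field of characteristic `p`).
* `ringKrullDim_eq_of_spanFinrank_eq` — bookkeeping `emb dim = d ⇒ dim = d` for regular local rings (Mathlib's definition).

References: H. Matsumura, *Commutative Ring Theory* (1986), Thm. 28.3 (ii) p. 215, Thm. 29.7 p. 227 and the proof of Thm. 29.4
p. 225 [Matsumura1987]; The Stacks Project, Tags 07NY, 0C0S [StacksProject]; tree twin for `K = κ(x)` and `ringKrullDim`: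
`exists_ringEquiv_adicCompletion_mvPowerSeries_of_rsop` (`AlterationsFormalCoordinates.lean`, de Jong 4.25 (i)) — re-derived here
because the frame needs the behaviour of `Ψ` on CONSTANTS (`Ψ (C a) = σ a`), which that statement does not export.
-/

noncomputable section

set_option linter.dupNamespace false -- mandated namespace of this single-conjunct summit
open MvPowerSeries IsLocalRing
open Literature.AlgebraicGeometry.Resolution

namespace Summit.ResolutionOfSingularities.ResolutionOfSingularities.Cruxes.SigmaMaxModifications.IdeasL1C5

universe u

namespace FormalFrame

/-! ### §0. Bookkeeping: embedding dimension and Krull dimension of a regular local ring -/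

/-- For a regular local ring, `emb dim R = d` gives `dim R = d` (Mathlib's definition of regularity is the equality
`(maximalIdeal R).spanFinrank = ringKrullDim R`). [folklore] -/
theorem ringKrullDim_eq_of_spanFinrank_eq {R : Type u} [CommRing R] [IsRegularLocalRing R] {d : ℕ}
    (hd : (maximalIdeal R).spanFinrank = d) : ringKrullDim R = d := by
  rw [← IsRegularLocalRing.spanFinrank_maximalIdeal, hd]

/-! ### §1. Cohen coordinates of `R̂` adapted to a given regular system of parameters of `R` -/

section Base

variable (R : Type u) [CommRing R] [IsRegularLocalRing R]

/-- **Cohen coordinates of the completion adapted to a given regular system of parameters, with control of the constants.**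
Let `R` be a regular local ring containing a field `k₀`, of embedding dimension `d`, and let `x : Fin d → R` generate `𝔪_R`.
Write `R̂` for the `𝔪`-adic completion and `κ` for the residue field of `R̂`. Then there are a coefficient field
`σ : κ →+* R̂` (`residue ∘ σ = id`) and a ring isomorphism `Ψ : κ⟦X_0, …, X_{d-1}⟧ ≃+* R̂` with `Ψ (X i) = x i` (the image of
`x i` in `R̂`) and `Ψ (C a) = σ a`. Proof: `R̂` is a complete regular local ring with `𝔪̂ = 𝔪 R̂ = (x)`, `emb dim R̂ = d`, containing
the field `k₀`; take a coefficient field `σ` (Matsumura 28.3 (ii)) and the expansion map `Φ ∘ map σ`, `X i ↦ x i`, which is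
bijective (`comp_map_bijective`, Matsumura 29.7 / proof of 29.4). [cite: Matsumura1987, Thm. 29.7] -/
theorem exists_cohenEquiv_of_rsop (k₀ : Subring R) (hk₀ : IsField k₀) {d : ℕ} (hd : (maximalIdeal R).spanFinrank = d)
    (x : Fin d → R) (hx : Ideal.span (Set.range x) = maximalIdeal R) :
    ∃ (σ : ResidueField (AdicCompletion (maximalIdeal R) R) →+* AdicCompletion (maximalIdeal R) R)
      (Ψ : MvPowerSeries (Fin d) (ResidueField (AdicCompletion (maximalIdeal R) R)) ≃+*
        AdicCompletion (maximalIdeal R) R),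
      (∀ a, residue _ (σ a) = a) ∧ (∀ a, Ψ (C a) = σ a) ∧
        ∀ i, Ψ (X i) = algebraMap R (AdicCompletion (maximalIdeal R) R) (x i) := by
  set A := AdicCompletion (maximalIdeal R) R with hA
  haveI : IsRegularLocalRing A := isRegularLocalRing_adicCompletion R
  -- `R → R̂` is injective (`R` is `𝔪`-adically separated)
  have hinj : Function.Injective (algebraMap R A) := fun a b h =>
    AdicCompletion.of_injective (maximalIdeal R) R h
  -- the field `k₀` inside `R̂`, and a coefficient field `σ`
  let k₁ : Subring A := k₀.map (algebraMap R A)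
  have hk₁ : IsField k₁ :=
    MulEquiv.isField hk₀ (k₀.equivMapOfInjective (algebraMap R A) hinj).symm.toMulEquiv
  obtain ⟨σ, hσ⟩ :=
    Literature.RingTheory.CompleteLocalRings.exists_ringHom_comp_residue_eq_id_of_subring A k₁ hk₁
  -- the regular system of parameters `x` of `R̂`
  let x' : Fin d → A := fun i => algebraMap R A (x i)
  have hmax : maximalIdeal A = (maximalIdeal R).map (algebraMap R A) :=
    AdicCompletion.maximalIdeal_eq_map
  have hx' : Ideal.span (Set.range x') = maximalIdeal A := by
    have h1 : (Ideal.span (Set.range x)).map (algebraMap R A) = Ideal.span (Set.range x') := by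
      rw [Ideal.map_span, ← Set.range_comp]
      rfl
    rw [← h1, congrArg (Ideal.map (algebraMap R A)) hx]
    exact hmax.symm
  have hx'm : ∀ i, x' i ∈ maximalIdeal A := fun i => hx' ▸ Ideal.subset_span ⟨i, rfl⟩
  have hd' : (maximalIdeal A).spanFinrank = d := by
    rw [AdicCompletion.spanFinrank_maximalIdeal_eq, hd]
  -- the expansion map `κ⟦X⟧ → R̂`, `X i ↦ x i`, `C a ↦ σ a`, is bijective
  obtain ⟨Φ, hΦ₁, hΦ₂⟩ := exists_adicEvalHom (maximalIdeal A) x' hx'm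
  have hbij := comp_map_bijective σ hσ hd' x' hx' Φ hΦ₁ hΦ₂
  refine ⟨σ, RingEquiv.ofBijective _ hbij, hσ, fun a => ?_, fun i => ?_⟩
  · rw [RingEquiv.ofBijective_apply, RingHom.comp_apply, MvPowerSeries.map_C, ← MvPolynomial.coe_C, hΦ₁,
      MvPolynomial.eval_C]
  · rw [RingEquiv.ofBijective_apply, RingHom.comp_apply, MvPowerSeries.map_X, ← MvPolynomial.coe_X, hΦ₁,
      MvPolynomial.eval_X]

/-- **The base formal frame.** In the situation of `exists_cohenEquiv_of_rsop`, the composite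
`ψ₀ := Ψ⁻¹ ∘ (R → R̂) : R →+* κ⟦X_0, …, X_{d-1}⟧` is a LOCAL homomorphism with `ψ₀ (x i) = X i`, every constant is a residue
(`∀ a : κ, ∃ r : R, ψ₀ r − C a ∈ 𝔪_{κ⟦X⟧}` — the residue field of `R̂` is that of `R`), and `Ψ (ψ₀ r)` is the image of `r` in `R̂`.
With `x 0 = t` these are the hypotheses `[IsLocalHom ψ]`, `hψt : ψ t = X 0` and the residue clause that
`FormalFrame.stepFrame` / `FormalFrame.mem_pow_of_frameTower` consume at stage `0` (slope `λ = 0`: `ψ₀ (x i) − X i − C 0 * X 0 = 0`).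
[cite: Matsumura1987, Thm. 29.7] -/
theorem exists_baseFrame_of_rsop (k₀ : Subring R) (hk₀ : IsField k₀) {d : ℕ} (hd : (maximalIdeal R).spanFinrank = d)
    (x : Fin d → R) (hx : Ideal.span (Set.range x) = maximalIdeal R) :
    ∃ (σ : ResidueField (AdicCompletion (maximalIdeal R) R) →+* AdicCompletion (maximalIdeal R) R)
      (Ψ : MvPowerSeries (Fin d) (ResidueField (AdicCompletion (maximalIdeal R) R)) ≃+*
        AdicCompletion (maximalIdeal R) R)
      (ψ₀ : R →+* MvPowerSeries (Fin d) (ResidueField (AdicCompletion (maximalIdeal R) R))),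
      (∀ a, residue _ (σ a) = a) ∧ (∀ a, Ψ (C a) = σ a) ∧
      (∀ i, Ψ (X i) = algebraMap R (AdicCompletion (maximalIdeal R) R) (x i)) ∧
      (∀ r, Ψ (ψ₀ r) = algebraMap R (AdicCompletion (maximalIdeal R) R) r) ∧
      IsLocalHom ψ₀ ∧ (∀ i, ψ₀ (x i) = X i) ∧
      ∀ a, ∃ r : R, ψ₀ r - C a ∈
        maximalIdeal (MvPowerSeries (Fin d) (ResidueField (AdicCompletion (maximalIdeal R) R))) := by
  set A := AdicCompletion (maximalIdeal R) R with hA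
  obtain ⟨σ, Ψ, hσ, hΨC, hΨX⟩ := exists_cohenEquiv_of_rsop R k₀ hk₀ hd x hx
  let ψ₀ : R →+* MvPowerSeries (Fin d) (ResidueField A) := Ψ.symm.toRingHom.comp (algebraMap R A)
  have hψ₀ : ∀ r, ψ₀ r = Ψ.symm (algebraMap R A r) := fun r => rfl
  -- `Ψ⁻¹` is a local homomorphism (an isomorphism), and so is `R → R̂`
  haveI hloc : IsLocalHom Ψ.symm.toRingHom :=
    isLocalHom_of_leftInverse Ψ.toRingHom fun z => Ψ.apply_symm_apply z
  refine ⟨σ, Ψ, ψ₀, hσ, hΨC, hΨX, fun r => ?_, RingHom.isLocalHom_comp _ _, fun i => ?_, fun a => ?_⟩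
  · rw [hψ₀, RingEquiv.apply_symm_apply]
  · rw [hψ₀, ← hΨX, RingEquiv.symm_apply_apply]
  · -- residue surjectivity: the residue field of `R̂` is that of `R`
    obtain ⟨b, hb⟩ := (AdicCompletion.residueField_map_bijective R).2 a
    obtain ⟨r, rfl⟩ := IsLocalRing.residue_surjective b
    refine ⟨r, ?_⟩
    have hmem : algebraMap R A r - σ a ∈ maximalIdeal A := by
      rw [← IsLocalRing.residue_eq_zero_iff, map_sub, hσ, ← ResidueField.map_residue, hb, sub_self]
    -- transport along the local homomorphism `Ψ⁻¹`
    have hC : C a = Ψ.symm (σ a) := by rw [← hΨC, RingEquiv.symm_apply_apply]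
    rw [hψ₀, hC, ← map_sub Ψ.symm]
    refine (IsLocalRing.mem_maximalIdeal _).mpr (mem_nonunits_iff.mpr fun hu => ?_)
    have hz : IsUnit (algebraMap R A r - σ a) := by simpa using hu.map Ψ
    exact (mem_nonunits_iff.mp ((IsLocalRing.mem_maximalIdeal _).mp hmem)) hz

end Base

/-! ### §2. Prime characteristic: the field `𝔽_p ⊆ R` -/

section CharP

variable (R : Type u) [CommRing R] [IsRegularLocalRing R]

/-- A local ring of prime characteristic `p` contains the field `𝔽_p` (the image of `ZMod p`). [folklore] -/
theorem exists_subring_isField_of_charP (p : ℕ) [Fact p.Prime] [CharP R p] : ∃ k₀ : Subring R, IsField k₀ := by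
  let φ : ZMod p →+* R := ZMod.castHom (dvd_refl p) R
  have hφ : Function.Injective φ := φ.injective
  refine ⟨φ.range, ?_⟩
  exact MulEquiv.isField (Field.toIsField (ZMod p)) (RingEquiv.ofBijective φ.rangeRestrict
    ⟨fun a b h => hφ (congrArg Subtype.val h), φ.rangeRestrict_surjective⟩).symm.toMulEquiv

/-- `exists_cohenEquiv_of_rsop` for `R` of prime characteristic `p`. [cite: Matsumura1987, Thm. 29.7] -/
theorem exists_cohenEquiv_of_rsop_of_charP (p : ℕ) [Fact p.Prime] [CharP R p] {d : ℕ}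
    (hd : (maximalIdeal R).spanFinrank = d)
    (x : Fin d → R) (hx : Ideal.span (Set.range x) = maximalIdeal R) :
    ∃ (σ : ResidueField (AdicCompletion (maximalIdeal R) R) →+* AdicCompletion (maximalIdeal R) R)
      (Ψ : MvPowerSeries (Fin d) (ResidueField (AdicCompletion (maximalIdeal R) R)) ≃+*
        AdicCompletion (maximalIdeal R) R),
      (∀ a, residue _ (σ a) = a) ∧ (∀ a, Ψ (C a) = σ a) ∧
        ∀ i, Ψ (X i) = algebraMap R (AdicCompletion (maximalIdeal R) R) (x i) := by
  obtain ⟨k₀, hk₀⟩ := exists_subring_isField_of_charP R p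
  exact exists_cohenEquiv_of_rsop R k₀ hk₀ hd x hx

/-- **The base formal frame in characteristic `p`** (`exists_baseFrame_of_rsop` with the field `𝔽_p ⊆ R`): for `R` regular local
of prime characteristic `p`, embedding dimension `d`, and generators `x` of `𝔪_R`, a coefficient field `σ` of `R̂`, Cohen coordinates
`Ψ : κ⟦X⟧ ≃+* R̂` with `Ψ (X i) = x i`, `Ψ (C a) = σ a`, and the local frame `ψ₀ = Ψ⁻¹ ∘ (R → R̂)` with `ψ₀ (x i) = X i` and
residue surjectivity. [cite: Matsumura1987, Thm. 29.7] -/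
theorem exists_baseFrame_of_rsop_of_charP (p : ℕ) [Fact p.Prime] [CharP R p] {d : ℕ}
    (hd : (maximalIdeal R).spanFinrank = d)
    (x : Fin d → R) (hx : Ideal.span (Set.range x) = maximalIdeal R) :
    ∃ (σ : ResidueField (AdicCompletion (maximalIdeal R) R) →+* AdicCompletion (maximalIdeal R) R)
      (Ψ : MvPowerSeries (Fin d) (ResidueField (AdicCompletion (maximalIdeal R) R)) ≃+*
        AdicCompletion (maximalIdeal R) R)
      (ψ₀ : R →+* MvPowerSeries (Fin d) (ResidueField (AdicCompletion (maximalIdeal R) R))),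
      (∀ a, residue _ (σ a) = a) ∧ (∀ a, Ψ (C a) = σ a) ∧
      (∀ i, Ψ (X i) = algebraMap R (AdicCompletion (maximalIdeal R) R) (x i)) ∧
      (∀ r, Ψ (ψ₀ r) = algebraMap R (AdicCompletion (maximalIdeal R) R) r) ∧
      IsLocalHom ψ₀ ∧ (∀ i, ψ₀ (x i) = X i) ∧
      ∀ a, ∃ r : R, ψ₀ r - C a ∈
        maximalIdeal (MvPowerSeries (Fin d) (ResidueField (AdicCompletion (maximalIdeal R) R))) := by
  obtain ⟨k₀, hk₀⟩ := exists_subring_isField_of_charP R p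
  exact exists_baseFrame_of_rsop R k₀ hk₀ hd x hx

end CharP

end FormalFrame

end Summit.ResolutionOfSingularities.ResolutionOfSingularities.Cruxes.SigmaMaxModifications.IdeasL1C5
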